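import Summits.CriticalPhenomena.PercolationContinuityZ3.Theorems.PercNearOneGluingNoHeavyLowerTailSahiSlotPairConeLiftCert

/-!
# THE TOP-SANDWICH LIFT: a full top layer over a pinned-good middle layer is pinned-good —
# `PinnedGood n D → PinnedGood (n+1) (D × {1} ∪ [3]^n × {2})`, every dimension, with an explicit identity

Support file of the one-cut programme (crux `NoHeavyLowerTail`, stmt-CriticalPhenomena-4575; cell `prim-masterthm`, seat P3, gen 24;
`run/shared/lean/prim/prim-masterthm/prim-masterthm-p3/HIERARCHY.md` §32, memo `FROM-prim-masterthm-p3-g24-CERTIFICATE-RULES.md`).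

CONTEXT.  An up-set `A ⊆ [3]^{n+1}` is a chain `A₀ ⊆ A₁ ⊆ A₂` of up-sets of `[3]^n` (slices along the last axis).  Generation 23 proved the
two PURE lifts at the certificate-format level (`…SahiSlotPairConeLifts`, `…LiftCert`): `(∅, D, D) = D × {1,2}` and `(∅, ∅, E) = E × {2}`, and
showed by exact LP that the general MIXED no-bottom chain `(∅, D, E)`, `D ⊊ E`, has NO universal certificate in the typed atom algebra.
THIS FILE proves the extreme mixed case `E = ⊤`:
* `topSand D := liftTwo D ∪ liftTop univ = D × {1} ∪ [3]^n × {2}` (slices `(∅, D, ⊤)`), an up-set when `D` is;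
* **`sStarD_topSand_eq`** (every `n`, ALL finsets `D, B, C`):
  `sStarD (topSand D) B C = sStarD D B₁ C₁ + sStarD D B₂ C₂ + 2·sStarD ⊤ B₂ C₂ + remSand D B C`,
  `remSand` = thirteen explicit terms of the kinds: diagonal point × vertical increment (weights `1 − 1_D` and `1`), opposite point ×
  vertical increment (weight `1_D` at either end), vertical increment × vertical increment at totally distinct points (weights `1`, `1 − 1_D`),
  a Latin increment × increment term with weight `1 − 1_D` at the third point, and two fibre-Kleitman terms of `D`;
* **`remSand_inPairCone`**: every term is in the pinned pair cone `C ⊗ C` (five new sign-trivial term lemmas `inPairCone_DgPV/DgVP/NbV/NcV/LfVV`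
  + gen 23's `inPairCone_PV/VP/VVc/Kb/Kc`), hence **`PinnedGood.topSand : PinnedGood n D → PinnedGood (n+1) (topSand D)`** and the value-level
  corollary `sStarD_topSand_nonneg`; all-dimension instances `pinnedGood_topSand_stackLift` (sandwiches over stacked orthants).
The identity was FOUND by linear programming (instance-based universal-identity search over gen 23's typed atom dictionary, jointly on all
up-sets of `[3]^1, [3]^2`; 16 active atoms, integer coefficients), then VERIFIED by pure evaluation on all 980 up-sets of `[3]^3` (forms on `[3]^4`,
deviation 0) and as a FORMAL identity (random real weights), and finally kernel-checked here (`ring` after prim-sahi-p1's `block_eq` ×18 and the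
three `univ` relations among atoms `Nf 1 g h = 2^n·Dg 1 g h`, `Nf g 1 h = Lf 1 g h`, `Lf 1 g h = Lf 1 h g`).  It is the `E = ⊤` endpoint of the
'top dominance' conjecture TD of memo g23 §3 (`M_{(∅,D,E)} − 2M_E^{(22)} ∈ C⊗C`): here `M_{(∅,D,⊤)} − 2M_⊤^{(22)} = M_D^{(11)} + M_D^{(22)} + remSand`.
The families `(D, ⊤, ⊤)`, `(D, D, ⊤)`, `(D, E, ⊤)`, `(D, E, E)`, `(D, D, E)` have NO typed universal certificate already at `n = 1` (memo §3).
HONEST LABEL: a certificate-format lift theorem in every dimension (new all-`d` family of good first slots); no open cell changes status.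
Pure, standard axioms. [this work]
-/

noncomputable section

namespace Summit.CriticalPhenomena.PercolationContinuityZ3.Theorems

open Finset Function

namespace SahiSlot

open SahiGridPattern SahiGrid3

variable {n : ℕ}

/-! ### Multilinearity in the first slot, and the `univ` relations among the atoms -/

/-- Multilinearity of `Dg` (first slot). [this work] -/
theorem Dg_sub₁ (f f' g h : Pd n → ℤ) : Dg (f - f') g h = Dg f g h - Dg f' g h := by
  simp only [Dg, Pi.sub_apply, ← Finset.sum_sub_distrib]; exact Finset.sum_congr rfl fun p _ => by ring

/-- Multilinearity of `Lf` (first slot: the weight at the third point). [this work] -/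
theorem Lf_sub₁ (f f' g h : Pd n → ℤ) : Lf (f - f') g h = Lf f g h - Lf f' g h := by
  simp only [Lf, Pi.sub_apply, ← Finset.sum_sub_distrib]
  exact Finset.sum_congr rfl fun p _ => Finset.sum_congr rfl fun q _ => by ring

/-- `1_{[3]^n} ≡ 1`. [this work] -/
theorem ind_univ_eq (p : Pd n) : ind (univ : Finset (Pd n)) p = 1 := by unfold ind; simp

/-- Indicator of a complement: `1_{[3]^n ∖ D} = 1 − 1_D`. [this work] -/
theorem ind_univ_sdiff (D : Finset (Pd n)) : ind (univ \ D) = ind (univ : Finset (Pd n)) - ind D := by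
  funext p; rw [Pi.sub_apply]; exact ind_sdiff_of_subset (Finset.subset_univ D) p

/-- `univ` relation 1: `N(1; g, h) = 2^n · Σ g h` (every point has `2^n` totally distinct partners). [this work] -/
theorem Nf_univ₁ (g h : Pd n → ℤ) : Nf (ind (univ : Finset (Pd n))) g h = 2 ^ n * Dg (ind (univ : Finset (Pd n))) g h := by
  unfold Nf Dg
  rw [Finset.sum_comm, Finset.mul_sum]
  refine Finset.sum_congr rfl fun q _ => ?_
  have hcnt : (∑ p : Pd n, (if TotDist p q = true then (1:ℤ) else 0)) = 2 ^ n := by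
    rw [Finset.sum_congr rfl fun p _ => by rw [totDist_symm p q]]
    exact sum_ite_totDist_eq_two_pow q
  calc (∑ p, ind univ p * g q * h q * (if TotDist p q = true then (1:ℤ) else 0))
      = g q * h q * ∑ p, (if TotDist p q = true then (1:ℤ) else 0) := by
          rw [Finset.mul_sum]; exact Finset.sum_congr rfl fun p _ => by rw [ind_univ_eq]; ring
    _ = 2 ^ n * (ind univ q * g q * h q) := by rw [hcnt, ind_univ_eq]; ring

/-- `univ` relation 2: `N(g; 1, h)` is the totally-distinct pair sum, i.e. the Latin atom with weight `1`. [this work] -/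
theorem Nf_univ₂ (g h : Pd n → ℤ) : Nf g (ind (univ : Finset (Pd n))) h = Lf (ind (univ : Finset (Pd n))) g h := by
  unfold Nf Lf
  exact Finset.sum_congr rfl fun p _ => Finset.sum_congr rfl fun q _ => by rw [ind_univ_eq, ind_univ_eq]; ring

/-- Symmetry of the weight-`1` Latin atom. [this work] -/
theorem Lf_univ_comm (g h : Pd n → ℤ) : Lf (ind (univ : Finset (Pd n))) g h = Lf (ind (univ : Finset (Pd n))) h g := by
  unfold Lf
  rw [Finset.sum_comm]
  exact Finset.sum_congr rfl fun a _ => Finset.sum_congr rfl fun b _ => by rw [ind_univ_eq, ind_univ_eq, totDist_symm b a]; ring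

/-! ### The sandwich set `D × {1} ∪ [3]^n × {2}` -/

/-- **The top sandwich** `topSand D = D × {1} ∪ [3]^n × {2} ⊆ [3]^{n+1}` (last axis): slices `(∅, D, [3]^n)`. [this work] -/
def topSand (D : Finset (Pd n)) : Finset (Pd (n + 1)) := liftTwo D ∪ liftTop univ

/-- Bottom slice of the sandwich is empty. [this work] -/
theorem sl_topSand_zero (D : Finset (Pd n)) : sl (topSand D) 0 = ∅ := by
  ext p; simp [topSand, sl, snoc_mem_liftTwo, snoc_mem_liftTop]
/-- Middle slice of the sandwich is `D`. [this work] -/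
theorem sl_topSand_one (D : Finset (Pd n)) : sl (topSand D) 1 = D := by
  ext p; simp [topSand, sl, snoc_mem_liftTwo, snoc_mem_liftTop]
/-- Top slice of the sandwich is everything. [this work] -/
theorem sl_topSand_two (D : Finset (Pd n)) : sl (topSand D) 2 = univ := by
  ext p; simp [topSand, sl, snoc_mem_liftTwo, snoc_mem_liftTop]

/-- The sandwich of an up-set is an up-set. [this work] -/
theorem isUpperSet_topSand {D : Finset (Pd n)} (hD : IsUpperSet (D : Set (Pd n))) :
    IsUpperSet ((topSand D : Finset (Pd (n + 1))) : Set (Pd (n + 1))) := by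
  rw [topSand, Finset.coe_union]
  exact (isUpperSet_liftTwo hD).union (isUpperSet_liftTop (by rw [Finset.coe_univ]; exact isUpperSet_univ))

/-! ### The remainder and the identity -/

/-- The explicit remainder of the top-sandwich lift (thirteen sign-trivial / fibre-Kleitman terms; weights `1_D`, `1`, `1 − 1_D`). [this work] -/
def remSand (D : Finset (Pd n)) (B C : Finset (Pd (n + 1))) : ℤ :=
  2 * 2 ^ n * Dg (ind (univ \ D)) (ind (sl B 2)) (ind (sl C 2) - ind (sl C 1))
  + 2 * 2 ^ n * Dg (ind (univ \ D)) (ind (sl B 2) - ind (sl B 1)) (ind (sl C 1))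
  + Nf (ind (sl B 2)) (ind D) (ind (sl C 2) - ind (sl C 1))
  + Nf (ind (sl C 2)) (ind D) (ind (sl B 2) - ind (sl B 1))
  + 2 ^ n * Dg (ind (univ : Finset (Pd n))) (ind (sl B 0)) (ind (sl C 1) - ind (sl C 0))
  + 2 ^ n * Dg (ind (univ : Finset (Pd n))) (ind (sl B 1) - ind (sl B 0)) (ind (sl C 1))
  + Nf (ind (sl C 2) - ind (sl C 1)) (ind (univ : Finset (Pd n))) (ind (sl B 2) - ind (sl B 1))
  + Nf (ind (sl C 1) - ind (sl C 0)) (ind (univ \ D)) (ind (sl B 2) - ind (sl B 1))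
  + Lf (ind (univ \ D)) (ind (sl B 2) - ind (sl B 0)) (ind (sl C 2) - ind (sl C 1))
  + Nf (ind D) (ind (sl B 0)) (ind (sl C 1) - ind (sl C 0))
  + Nf (ind D) (ind (sl B 1) - ind (sl B 0)) (ind (sl C 1))
  + (Nf (ind (sl B 1) - ind (sl B 0)) (ind D) (ind (sl C 1)) - Lf (ind D) (ind (sl B 1) - ind (sl B 0)) (ind (sl C 1)))
  + (Nf (ind (sl C 1) - ind (sl C 0)) (ind D) (ind (sl B 2)) - Lf (ind D) (ind (sl B 2)) (ind (sl C 1) - ind (sl C 0)))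

/-- **THE TOP-SANDWICH IDENTITY** (every `n`, all finsets `D, B, C`):
`sStarD (D×{1} ∪ ⊤×{2}) B C = sStarD D B₁ C₁ + sStarD D B₂ C₂ + 2·sStarD ⊤ B₂ C₂ + remSand D B C`. [this work] -/
theorem sStarD_topSand_eq (D : Finset (Pd n)) (B C : Finset (Pd (n + 1))) :
    sStarD (topSand D) B C = sStarD D (sl B 1) (sl C 1) + sStarD D (sl B 2) (sl C 2)
      + 2 * sStarD (univ : Finset (Pd n)) (sl B 2) (sl C 2) + remSand D B C := by
  rw [sStarD_eq_sum_ind]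
  simp only [sum_snoc, Fin.sum_univ_three, ind_sl, sl_topSand_zero, sl_topSand_one, sl_topSand_two, ind_empty_eq, zero_mul,
    Finset.sum_const_zero, zero_add, Finset.sum_add_distrib]
  rw [block_eq_atoms, block_eq_atoms, block_eq_atoms, block_eq_atoms, block_eq_atoms, block_eq_atoms, block_eq_atoms, block_eq_atoms,
    block_eq_atoms, block_eq_atoms, block_eq_atoms, block_eq_atoms, block_eq_atoms, block_eq_atoms, block_eq_atoms, block_eq_atoms,
    block_eq_atoms, block_eq_atoms]
  obtain ⟨h0, h1, h2, h3, h4, h5, h6, h7, h8, h9, h10, h11, h12, h13, h14, h15, h16, h17, h18, h19, h20, h21, h22, h23, h24, h25, h26, h27, h28, h29, h30, h31, h32, h33, h34, h35, h36, h37, h38, h39, h40, h41, h42, h43, h44, h45, h46, h47, h48, h49, h50, h51, h52, h53, h54, h55, h56, h57, h58, h59⟩ := c_vals_liftTwo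
  simp only [h0, h1, h2, h3, h4, h5, h6, h7, h8, h9, h10, h11, h12, h13, h14, h15, h16, h17, h18, h19, h20, h21, h22, h23, h24, h25, h26, h27, h28, h29, h30, h31, h32, h33, h34, h35, h36, h37, h38, h39, h40, h41, h42, h43, h44, h45, h46, h47, h48, h49, h50, h51, h52, h53, h54, h55, h56, h57, h58, h59]
  rw [sStarD_counting_atoms, sStarD_counting_atoms, sStarD_counting_atoms]
  simp only [remSand, ind_univ_sdiff, Dg_sub₁, Dg_sub₂, Dg_sub₃, Nf_sub₁, Nf_sub₂, Nf_sub₃, Lf_sub₁, Lf_sub₂, Lf_sub₃, Nf_univ₁, Nf_univ₂]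
  rw [Lf_univ_comm (ind (sl C 0)) (ind (sl B 2)), Lf_univ_comm (ind (sl C 1)) (ind (sl B 2)), Lf_univ_comm (ind (sl C 2)) (ind (sl B 2)),
    Lf_univ_comm (ind (sl C 2)) (ind (sl B 1)), Lf_univ_comm (ind (sl C 1)) (ind (sl B 1)), Lf_univ_comm (ind (sl C 0)) (ind (sl B 1))]
  ring

/-! ### The remainder is in the pair cone: five more sign-trivial term kinds -/

/-- Diagonal point × vertical increment `Σ_p w(p)·1_B(p,m)·(1_C(p,k) − 1_C(p,j))`, `w = 1_W ≥ 0`. [this work] -/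
theorem inPairCone_DgPV (W : Finset (Pd n)) (m : Fin 3) {j k : Fin 3} (hjk : j ≤ k) :
    InPairCone (n + 1) (fun B C => ((Dg (ind W) (ind (sl B m)) (ind (sl C k) - ind (sl C j)) : ℤ) : ℝ)) := by
  have hw : ∀ p ∈ (univ : Finset (Pd n)), (0:ℝ) ≤ (ind W p : ℝ) := fun p _ => by exact_mod_cast ind_nonneg' W p
  refine (InPairCone.sum_smul univ hw fun p _ => InPairCone.mul (InCone.point (Fin.snoc p m : Pd (n + 1))) (InCone.vincr p hjk)).congr
    fun B C _ _ => ?_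
  unfold Dg
  push_cast
  refine Finset.sum_congr rfl fun p _ => ?_
  simp only [Pi.sub_apply, Int.cast_sub, cast_ind_sl]
  ring

/-- Diagonal vertical increment × point `Σ_p w(p)·(1_B(p,k) − 1_B(p,j))·1_C(p,m)`. [this work] -/
theorem inPairCone_DgVP (W : Finset (Pd n)) {j k : Fin 3} (hjk : j ≤ k) (m : Fin 3) :
    InPairCone (n + 1) (fun B C => ((Dg (ind W) (ind (sl B k) - ind (sl B j)) (ind (sl C m)) : ℤ) : ℝ)) := by
  have hw : ∀ p ∈ (univ : Finset (Pd n)), (0:ℝ) ≤ (ind W p : ℝ) := fun p _ => by exact_mod_cast ind_nonneg' W p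
  refine (InPairCone.sum_smul univ hw fun p _ => InPairCone.mul (InCone.vincr p hjk) (InCone.point (Fin.snoc p m : Pd (n + 1)))).congr
    fun B C _ _ => ?_
  unfold Dg
  push_cast
  refine Finset.sum_congr rfl fun p _ => ?_
  simp only [Pi.sub_apply, Int.cast_sub, cast_ind_sl]
  ring

/-- Opposite point × vertical increment, the `B`-point at the free end: `Σ_{p δ̸ q} 1_B(p,m)·w(q)·(1_C(q,k) − 1_C(q,j))`. [this work] -/
theorem inPairCone_NbV (W : Finset (Pd n)) (m : Fin 3) {j k : Fin 3} (hjk : j ≤ k) :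
    InPairCone (n + 1) (fun B C => ((Nf (ind (sl B m)) (ind W) (ind (sl C k) - ind (sl C j)) : ℤ) : ℝ)) := by
  have hw : ∀ x ∈ (univ : Finset (Pd n × Pd n)), (0:ℝ) ≤ (ind W x.2 : ℝ) * (if TotDist x.1 x.2 = true then (1:ℝ) else 0) :=
    fun x _ => mul_nonneg (by exact_mod_cast ind_nonneg' W x.2) (by split_ifs <;> norm_num)
  refine (InPairCone.sum_smul univ hw fun x _ => InPairCone.mul (InCone.point (Fin.snoc x.1 m : Pd (n + 1))) (InCone.vincr x.2 hjk)).congr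
    fun B C _ _ => ?_
  unfold Nf
  push_cast
  rw [← Finset.univ_product_univ, Finset.sum_product]
  refine Finset.sum_congr rfl fun p _ => Finset.sum_congr rfl fun q _ => ?_
  simp only [Pi.sub_apply, Int.cast_sub, cast_ind_sl]
  ring

/-- Opposite point × vertical increment, the `C`-point at the free end: `Σ_{p δ̸ q} 1_C(p,m)·w(q)·(1_B(q,k) − 1_B(q,j))`. [this work] -/
theorem inPairCone_NcV (W : Finset (Pd n)) (m : Fin 3) {j k : Fin 3} (hjk : j ≤ k) :
    InPairCone (n + 1) (fun B C => ((Nf (ind (sl C m)) (ind W) (ind (sl B k) - ind (sl B j)) : ℤ) : ℝ)) := by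
  have hw : ∀ x ∈ (univ : Finset (Pd n × Pd n)), (0:ℝ) ≤ (ind W x.2 : ℝ) * (if TotDist x.1 x.2 = true then (1:ℝ) else 0) :=
    fun x _ => mul_nonneg (by exact_mod_cast ind_nonneg' W x.2) (by split_ifs <;> norm_num)
  refine (InPairCone.sum_smul univ hw fun x _ => InPairCone.mul (InCone.vincr x.2 hjk) (InCone.point (Fin.snoc x.1 m : Pd (n + 1)))).congr
    fun B C _ _ => ?_
  unfold Nf
  push_cast
  rw [← Finset.univ_product_univ, Finset.sum_product]
  refine Finset.sum_congr rfl fun p _ => Finset.sum_congr rfl fun q _ => ?_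
  simp only [Pi.sub_apply, Int.cast_sub, cast_ind_sl]
  ring

/-- Latin increment × increment with a nonnegative weight at the third point:
`Σ_{q δ̸ r} (1_B(q,k) − 1_B(q,j))·(1_C(r,k') − 1_C(r,j'))·w(q̄r)`. [this work] -/
theorem inPairCone_LfVV (W : Finset (Pd n)) {j k j' k' : Fin 3} (hjk : j ≤ k) (hjk' : j' ≤ k') :
    InPairCone (n + 1) (fun B C => ((Lf (ind W) (ind (sl B k) - ind (sl B j)) (ind (sl C k') - ind (sl C j')) : ℤ) : ℝ)) := by
  have hw : ∀ x ∈ (univ : Finset (Pd n × Pd n)), (0:ℝ) ≤ (ind W (thirdPt x.1 x.2) : ℝ) * (if TotDist x.1 x.2 = true then (1:ℝ) else 0) :=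
    fun x _ => mul_nonneg (by exact_mod_cast ind_nonneg' W (thirdPt x.1 x.2)) (by split_ifs <;> norm_num)
  refine (InPairCone.sum_smul univ hw fun x _ => InPairCone.mul (InCone.vincr x.1 hjk) (InCone.vincr x.2 hjk')).congr fun B C _ _ => ?_
  unfold Lf
  push_cast
  rw [← Finset.univ_product_univ, Finset.sum_product]
  refine Finset.sum_congr rfl fun p _ => Finset.sum_congr rfl fun q _ => ?_
  simp only [Pi.sub_apply, Int.cast_sub, cast_ind_sl]
  ring

/-- **The sandwich remainder is in the pair cone** (for an up-set `D`). [this work] -/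
theorem remSand_inPairCone {D : Finset (Pd n)} (hD : IsUpperSet (D : Set (Pd n))) :
    InPairCone (n + 1) (fun B C => (remSand D B C : ℝ)) := by
  have h01 : (0 : Fin 3) ≤ 1 := by decide
  have h12 : (1 : Fin 3) ≤ 2 := by decide
  have h02 : (0 : Fin 3) ≤ 2 := by decide
  have e1 := ((inPairCone_DgPV (univ \ D) 2 h12).smul (by positivity : (0:ℝ) ≤ 2 * 2 ^ n))
  have e2 := ((inPairCone_DgVP (univ \ D) h12 1).smul (by positivity : (0:ℝ) ≤ 2 * 2 ^ n))
  have e3 := inPairCone_NbV D 2 h12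
  have e4 := inPairCone_NcV D 2 h12
  have e5 := ((inPairCone_DgPV (univ : Finset (Pd n)) 0 h01).smul (by positivity : (0:ℝ) ≤ 2 ^ n))
  have e6 := ((inPairCone_DgVP (univ : Finset (Pd n)) h01 1).smul (by positivity : (0:ℝ) ≤ 2 ^ n))
  have e7 := inPairCone_VVc (univ : Finset (Pd n)) h12 h12
  have e8 := inPairCone_VVc (univ \ D) h12 h01
  have e9 := inPairCone_LfVV (univ \ D) h02 h12
  have e10 := inPairCone_PV D 0 h01
  have e11 := inPairCone_VP D h01 1
  have e12 := inPairCone_Kb hD h01 1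
  have e13 := inPairCone_Kc hD h01 2
  refine ((((((((((((e1.add e2).add e3).add e4).add e5).add e6).add e7).add e8).add e9).add e10).add e11).add e12).add e13).congr
    fun B C _ _ => ?_
  simp only [remSand]
  push_cast
  ring

/-- **THE TOP-SANDWICH LIFT at the format level**: if the up-set `D ⊆ [3]^n` has a pinned (pivotal-pair) certificate, so does
`D × {1} ∪ [3]^n × {2} ⊆ [3]^{n+1}` — explicitly: the two diagonal slice certificates of `D`, twice the Harris-slack certificate of `⊤`
on the top layer, and the thirteen-term remainder. [this work] -/
theorem PinnedGood.topSand {D : Finset (Pd n)} (hD : IsUpperSet (D : Set (Pd n))) (h : PinnedGood n D) :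
    PinnedGood (n + 1) (topSand D) := by
  refine ((((h.slices 1 1).add (h.slices 2 2)).add (((pinnedGood_univ n).slices 2 2).smul (by norm_num : (0:ℝ) ≤ 2))).add
    (remSand_inPairCone hD)).congr fun B C _ _ => ?_
  rw [sStarD_topSand_eq]; push_cast; ring

/-- VALUE-LEVEL corollary: the sandwich of a pinned-good up-set is a good first slot — `sStarD (D×{1} ∪ ⊤×{2}) B C ≥ 0` for all up-sets
`B, C`. [this work] -/
theorem sStarD_topSand_nonneg {D : Finset (Pd n)} (hD : IsUpperSet (D : Set (Pd n))) (h : PinnedGood n D) (B C : Finset (Pd (n + 1)))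
    (hB : IsUpperSet (B : Set (Pd (n + 1)))) (hC : IsUpperSet (C : Set (Pd (n + 1)))) : 0 ≤ sStarD (topSand D) B C :=
  (h.topSand hD).sStarD_nonneg B C hB hC

/-- All-dimension instances: the sandwich over a stacked orthant, e.g. `{x : x_n ≥ 1} × {1} ∪ ⊤ × {2} ⊆ [3]^{n+2}`, is pinned-good. [this work] -/
theorem pinnedGood_topSand_stackLift (n : ℕ) (ls : List Bool) : PinnedGood (n + ls.length + 1) (topSand (stackLift n ls)) :=
  (pinnedGood_stackLift n ls).topSand (isUpperSet_stackLift n ls)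

end SahiSlot

end Summit.CriticalPhenomena.PercolationContinuityZ3.Theorems
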